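import Summits.QuantumFields.YangMills.Theses.HyperbolicRegulator
import Literature.MathematicalPhysics.QuantumLattice.LatticeGaugeDLR

/-!
# Route `HyperbolicRegulator`, crux `HyperbolicToTorusR` (stmt-QuantumFields-18156): vocabulary of the line `replica-rooting`

Route-posited objects (D-0016 `<Route><Crux>Defs` file) shared by the registered skeleton
`Cruxes/HyperbolicToTorusR/Lines/replica_rooting.lean` (strategist `planner-cstrat-stmt-QuantumFields-18156-b1-0`, skeleton sha
`79b7961b…`, lead `prover-line-stmt-QuantumFields-18156-0`) and by the stub files that prove its registered stubs
(`stub_rootedPairLimit`, `stub_pressureTangentUnique`, `stub_extremalInvariantStates`, `stub_replicaDecoupling`,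
`stub_torusFiniteSize`).  NOTHING here is asserted about the route: the file contains the definitions of the skeleton, BYTE FOR
BYTE and in the skeleton's namespace (so that every stub file and the final composition elaborate against one copy), and two
`rfl` simp lemmas.

* `Fam` — verbatim the crux's `let Fam := …` (the PAIR: admissibility A1–A9 of one finite square complex at curvature scale `k`
  and separation index `j`, flat `k/2 <`, deep `3(k/4) <`, `ℤ²`-charts of sup-radius `k/4`; and the chart-read clustering
  predicate of Wilson's theory on the product complex `S × S`), as a function of the gauge group data `(G, r)`.
* `Sp` — verbatim the crux's `let Sp := …` (support radius of a species).
* `IsRootedPairState r β Q` — a probability measure on two replicas `Ω × Ω` (`Ω = LGConfig 4 G`) that is swap-symmetric,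
  conditionally DLR for `ymSpecification r.ρ β` in the second replica given the first, with translation-invariant first
  marginal (the meeting point of the stubs H₂ `stub_rootedPairLimit` and RT `stub_replicaDecoupling`).
* `shiftObs`, `prodObs` — translates and products of gauge-invariant local observables (species algebra used by the glue).
* `IsPairApprox r β m C A B P` (appended, reshape r2) — approximating sequence of rooted two-replica laws: the seam between
  H₂a `stub_rootedPairApprox` (finite-`k` construction from the family) and H₂b `stub_pairLimit` (abstract weak-limit step).

References: the route file `Theses/HyperbolicRegulator.lean` for the crux; `Cruxes/HyperbolicToTorusR/PICKED.md`,
`Lines/replica-rooting.md` and `STRATEGY-CENSUS.md` for the line.  Folklore vocabulary (Georgii 2011 Ch. 1, 5, 7;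
Friedli–Velenik 2017 Ch. 6); no published theorem is restated here.
-/

set_option autoImplicit false

noncomputable section

namespace Summit.QuantumFields.YangMills.Cruxes.HyperbolicToTorusR.ReplicaRooting

open scoped BigOperators Topology Classical MeasureTheory ProbabilityTheory Matrix ENNReal
open Filter Set Function TopologicalSpace MeasureTheory
open Literature.MathematicalPhysics.QuantumFieldTheory (LatticeRep YMSpecies haarProbability)
open Literature.Probability.LatticeModels (Site)
open Literature.MathematicalPhysics.QuantumLattice (LGConfig ZdEdge configShift configShift_apply gaugeTransformZd
  IsZdGaugeInvariant IsZdTranslationInvariant IsCylinder LocalGaugeObservable ymSpecification)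

/-! ## The route's REPAIRED hyperbolic-family vocabulary, named (byte-identical with `HyperbolicToTorusR`'s `let Fam` / `let Sp`) -/

section Vocabulary

variable (G : Type) [Group G] [TopologicalSpace G] [IsTopologicalGroup G] [CompactSpace G]
  [MeasurableSpace G] [BorelSpace G]

/-- **The repaired hyperbolic-family vocabulary of route `HyperbolicRegulator`** (flat `k/2 <`, deep `3(k/4) <`, chart
sup-radius `k/4`): the PAIR (admissibility A1–A9, chart-read clustering predicate on `S × S`). -/
def Fam (r : LatticeRep G) :=
  fun (k j : ℕ) (V E Q : Finset ℕ) (σ τ : ℕ → ℕ) (bd : ℕ → Fin 4 → ℕ × Bool) (cV : ℕ → ℤ × ℤ → ℕ) (cE : ℕ → ℤ × ℤ → Fin 2 → ℕ × Bool) => let st := fun e : ℕ × Bool => if e.2 then σ e.1 else τ e.1; let en := fun e : ℕ × Bool => if e.2 then τ e.1 else σ e.1; let Γ := SimpleGraph.fromRel fun a b : ℕ => ∃ e ∈ E, σ e = a ∧ τ e = b; let dg := fun x : ℕ => (E.filter fun e => σ e = x ∨ τ e = x).card; let K := V.filter fun x => dg x = 5; let F := fun x : ℕ => x ∈ V ∧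 ∀ c ∈ K, k / 2 < Γ.dist x c; let Dp := fun x : ℕ => x ∈ V ∧ ∀ c ∈ K, 3 * (k / 4) < Γ.dist x c; let ib := fun a : ℤ × ℤ => |a.1| ≤ (k : ℤ) / 4 ∧ |a.2| ≤ (k : ℤ) / 4; let nx := fun (a : ℤ × ℤ) (μ : Fin 2) => if μ = 0 then (a.1 + 1, a.2) else (a.1, a.2 + 1); let Ed := (ℕ × ℕ) ⊕ (ℕ × ℕ); let PE : Finset Ed := (E ×ˢ V).disjSum (V ×ˢ E); let Cfg := ↥PE → G; let ν := Measure.pi fun _ : ↥PE => haarProbability G; let v := fun (U : Cfg) (e : Ed × Bool) => if h : e.1 ∈ PE then (if e.2 then U ⟨e.1, h⟩ else (U ⟨e.1, h⟩)⁻¹) else 1; let w := fun (U : Cfg) (e : Fin 4 → Ed × Bool) => (r.ρ (v U (e 0) * v U (e 1) * v U (e 2) * v U (e 3))).trace.re; let S := fun U : Cfg => (∑ q ∈ Q, ∑ y ∈ V, w U fun i => (Sum.inl ((bd q i).1, y), (bd q i).2)) + (∑ y ∈ V, ∑ q ∈ Q, w U fun i => (Sum.inr (y, (bd q i).1), (bd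 q i).2)) + ∑ e ∈ E, ∑ e' ∈ E, w U ![(Sum.inl (e, σ e'), true), (Sum.inr (τ e, e'), true), (Sum.inl (e, τ e'), false), (Sum.inr (σ e, e'), false)]; let d0 : Fin 4 → Fin 2 := ![0, 1, 0, 1]; let P := fun (x x' : ℕ) (U : Cfg) (p : ZdEdge 4) => let a := (p.1 0, p.1 1); let b := (p.1 2, p.1 3); if p.2 = 0 ∨ p.2 = 1 then v U (Sum.inl ((cE x a (d0 p.2)).1, cV x' b), (cE x a (d0 p.2)).2) else v U (Sum.inr (cV x a, (cE x' b (d0 p.2)).1), (cE x' b (d0 p.2)).2); ((∀ e ∈ E, σ e ∈ V ∧ τ e ∈ V ∧ σ e ≠ τ e) ∧ (∀ q ∈ Q, (∀ i, (bd q i).1 ∈ E) ∧ (∀ i, en (bd q i) = st (bd q (i + 1))) ∧ (st ∘ bd q).Injective) ∧ (∀ e ∈ E, (Q.filter fun q => ∃ i, (bd q i).1 = e).card = 2) ∧ (∀ x ∈ V, (dg x = 4 ∨ dg x = 5) ∧ (Q.filter fun q => ∃ i, st (bd q i) = x).card = dg x) ∧ (∀ x ∈ V, ∃ c ∈ K,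 Γ.dist x c ≤ k) ∧ (∀ c ∈ K, ∀ c' ∈ K, c ≠ c' → k ≤ Γ.dist c c') ∧ (∀ f : ℕ → ℝ, ∑ x ∈ V, f x = 0 → ∑ x ∈ V, f x ^ 2 ≤ 10 ^ 6 * (k : ℝ) ^ 2 * ∑ e ∈ E, (f (σ e) - f (τ e)) ^ 2) ∧ (∃ x y, Dp x ∧ Dp y ∧ j ≤ Γ.dist x y) ∧ (∀ x, F x → cV x (0, 0) = x ∧ (∀ a, ib a → cV x a ∈ V) ∧ Set.InjOn (cV x) {a | ib a} ∧ (∀ a μ, ib a → ib (nx a μ) → (cE x a μ).1 ∈ E ∧ st (cE x a μ) = cV x a ∧ en (cE x a μ) = cV x (nx a μ)) ∧ (∀ a, ib a → ib (a.1 + 1, a.2 + 1) → ∃ q ∈ Q, Finset.univ.image (Prod.fst ∘ bd q) = {(cE x a 0).1, (cE x (nx a 0) 1).1, (cE x (nx a 1) 0).1, (cE x a 1).1})), fun (β m C : ℝ) (A B : YMSpecies G) => let X := fun f : Cfg → ℝ => (∫ U, f U * Real.exp (β * S U) ∂ν) / (∫ U, Real.exp (β * S U) ∂ν); ∀ x x'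 y y', F x → F x' → F y → F y' → |X (fun U => A.F (P x x' U) * B.F (P y y' U)) - X (fun U => A.F (P x x' U)) * X (fun U => B.F (P y y' U))| ≤ C * Real.exp (-(m * ((Γ.dist x y + Γ.dist x' y' : ℕ) : ℝ))))

variable {G} in
/-- **Support radius** — byte for byte the route's `let Sp := …`. -/
def Sp : YMSpecies G → ℕ → Prop :=
  fun (A : YMSpecies G) (R : ℕ) => ∀ p ∈ A.supp, ∀ i, |p.1 i| ≤ (R : ℤ)

variable {G} in
/-- **Rooted pair state at `β`.**  A probability measure `Q` on `Ω × Ω` (two replicas of the `ℤ⁴` gauge field) which is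
(a) symmetric under the swap of the replicas, (b) CONDITIONALLY DLR in the second replica given the first — for every finite
edge set `Λ` and measurable `E ⊆ Ω × Ω`, resampling the second configuration inside `Λ` by Wilson's kernel `γ_Λ(· | ω₂)`
leaves `Q` invariant (so both marginals are DLR states of `ymSpecification r.ρ β`, and a disintegration of `Q` over `ω₁` has
DLR fibres a.s.), and (c) has translation-invariant first marginal.  The meeting point of the rooted-limit step (H₂) and the
decoupling step (RT): the law of two independent samples from a uniformly-rooted chart-local state. -/
def IsRootedPairState (r : LatticeRep G) (β : ℝ) (Q : Measure (LGConfig 4 G × LGConfig 4 G)) : Prop :=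
  IsProbabilityMeasure Q ∧ Q.map Prod.swap = Q ∧
    (∀ (Λ : Finset (ZdEdge 4)) (E : Set (LGConfig 4 G × LGConfig 4 G)), MeasurableSet E →
      ∫⁻ p, ymSpecification (d := 4) r.ρ β Λ p.2 ((fun ζ => (p.1, ζ)) ⁻¹' E) ∂Q = Q E) ∧
    IsZdTranslationInvariant (Q.map Prod.fst)

end Vocabulary

/-! ## Species algebra used by the glue: shifted and product gauge-invariant local observables -/

section SpeciesAlgebra

variable {G : Type} [Group G] [MeasurableSpace G]

/-- The translate `U ↦ B(θ_v U)` of a gauge-invariant local observable is again one. [folklore] -/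
def shiftObs (B : LocalGaugeObservable 4 G) (v : Site 4) : LocalGaugeObservable 4 G where
  F := fun U => B.F (configShift v U)
  supp := B.supp.image fun e => (e.1 - v, e.2)
  isCylinder := by
    intro U V h
    refine B.isCylinder fun e he => ?_
    simp only [configShift_apply]
    exact h (e.1 - v, e.2) (Finset.mem_coe.2 (Finset.mem_image_of_mem (fun e : Literature.MathematicalPhysics.QuantumLattice.ZdEdge 4 => (e.1 - v, e.2))
      (Finset.mem_coe.1 he)))
  gaugeInvariant := by
    intro g U
    have hshift : configShift v (gaugeTransformZd g U) =
        gaugeTransformZd (fun x => g (x - v)) (configShift v U) := by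
      funext e
      simp only [configShift_apply, gaugeTransformZd, sub_add_eq_add_sub]
    show B.F (configShift v (gaugeTransformZd g U)) = B.F (configShift v U)
    rw [hshift, B.gaugeInvariant]
  bounded := by
    obtain ⟨C, hC⟩ := B.bounded
    exact ⟨C, fun U => hC _⟩
  measurable := B.measurable.comp (configShift v).measurable

/-- The product of two gauge-invariant local observables is one. [folklore] -/
def prodObs (A B : LocalGaugeObservable 4 G) : LocalGaugeObservable 4 G where
  F := fun U => A.F U * B.F U
  supp := A.supp ∪ B.supp
  isCylinder := by
    intro U V h
    show A.F U * B.F U = A.F V * B.F V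
    rw [A.isCylinder fun e he => h e (by simp [Finset.mem_coe.1 he]),
      B.isCylinder fun e he => h e (by simp [Finset.mem_coe.1 he])]
  gaugeInvariant := by
    intro g U
    show A.F (gaugeTransformZd g U) * B.F (gaugeTransformZd g U) = A.F U * B.F U
    rw [A.gaugeInvariant, B.gaugeInvariant]
  bounded := by
    obtain ⟨a, ha⟩ := A.bounded
    obtain ⟨b, hb⟩ := B.bounded
    refine ⟨a * b, fun U => ?_⟩
    rw [abs_mul]
    exact mul_le_mul (ha U) (hb U) (abs_nonneg _) ((abs_nonneg _).trans (ha U))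
  measurable := A.measurable.mul B.measurable

/-- `shiftObs` unfolded. [folklore] -/
@[simp] theorem shiftObs_F (B : LocalGaugeObservable 4 G) (v : Site 4) (U : LGConfig 4 G) :
    (shiftObs B v).F U = B.F (configShift v U) := rfl

/-- `prodObs` unfolded. [folklore] -/
@[simp] theorem prodObs_F (A B : LocalGaugeObservable 4 G) (U : LGConfig 4 G) :
    (prodObs A B).F U = A.F U * B.F U := rfl

end SpeciesAlgebra


/-! ## Approximating rooted two-replica laws (reshape r2 of stub H₂: H₂ = H₂a `stub_rootedPairApprox` + H₂b `stub_pairLimit`) -/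

section PairApprox

variable {G : Type} [Group G] [TopologicalSpace G] [IsTopologicalGroup G] [CompactSpace G]
  [MeasurableSpace G] [BorelSpace G]

/-- **Approximating sequence of rooted two-replica laws** for the pair of species `(A, B)` at coupling `β`,
rate `m` and table constant `C`: probability measures `P k` on `Ω × Ω` (`Ω = LGConfig 4 G`) that are
(1) probability, (2) swap-symmetric, (3) EVENTUALLY conditionally DLR in the second replica for Wilson's kernel
`γ_Λ = ymSpecification r.ρ β Λ`, tested on bounded measurable JOINT cylinder functions `h(ω₁, ω₂)`
(`∫ h dP_k = ∫ (∫ h(ω₁, ζ) γ_Λ(dζ | ω₂)) dP_k` for all large `k`), (4) asymptotically translation invariant in the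
first replica on bounded measurable functions, and (5) eventually obey the cross-replica table
`|∫ A(ω₁) τₙB(ω₁) dP_k − ∫ A(ω₁) τₙB(ω₂) dP_k| ≤ C e^{−mn}` for each `n`.  At finite curvature scale `k` this is
what the root-averaged law of two independent chart-read samples of the hyperbolic family delivers (H₂a); any
weak limit point is a rooted pair state with the table (H₂b). [folklore] -/
def IsPairApprox (r : LatticeRep G) (β m C : ℝ) (A B : YMSpecies G)
    (P : ℕ → Measure (LGConfig 4 G × LGConfig 4 G)) : Prop :=
  (∀ k, IsProbabilityMeasure (P k)) ∧
  (∀ k, (P k).map Prod.swap = P k) ∧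
  (∀ (Λ S₀ : Finset (ZdEdge 4)) (h : LGConfig 4 G × LGConfig 4 G → ℝ), Measurable h →
      (∀ p q : LGConfig 4 G × LGConfig 4 G,
        (∀ e ∈ S₀, p.1 e = q.1 e) → (∀ e ∈ S₀, p.2 e = q.2 e) → h p = h q) →
      (∃ Ch : ℝ, ∀ p, |h p| ≤ Ch) →
      ∀ᶠ k in atTop, ∫ p, h p ∂P k = ∫ p, (∫ ζ, h (p.1, ζ) ∂(ymSpecification r.ρ β Λ p.2)) ∂P k) ∧
  (∀ (v : Site 4) (f : LGConfig 4 G → ℝ), Measurable f → (∃ Cf : ℝ, ∀ U, |f U| ≤ Cf) →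
      Tendsto (fun k => (∫ p, f (configShift v p.1) ∂P k) - ∫ p, f p.1 ∂P k) atTop (𝓝 0)) ∧
  (∀ n : ℕ, ∀ᶠ k in atTop,
      |(∫ p, A.F p.1 * B.F (configShift (-Pi.single 0 (n : ℤ)) p.1) ∂P k) -
          ∫ p, A.F p.1 * B.F (configShift (-Pi.single 0 (n : ℤ)) p.2) ∂P k| ≤ C * Real.exp (-(m * n)))

end PairApprox

end Summit.QuantumFields.YangMills.Cruxes.HyperbolicToTorusR.ReplicaRooting

end
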